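import Mathlib
import HarnessLib
import Literature.MathematicalPhysics.KineticTheory.HardSphereEulerProofs
import Literature.Analysis.FluidPDE.CollisionalTransfer
import Summits.AtomisticToContinuum.HydrodynamicLimit.Theorems.OneFlightGossipEngineKineticCurrentsWindowLDUniformWindowRenyiOfTransportPrelim
import Summits.AtomisticToContinuum.HydrodynamicLimit.Theorems.OneFlightGossipEngineEquilibriumClampedCollisionalWindowLDRadialVirialTemplate

/-!
# Rényi quasi-invariance of local Gibbs laws over a kinetic window FROM kinetic-window transport tightness

Helper toward the registered (shared, research-level) stub `stub_windowRenyi` of the crux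
`KineticCurrentsWindowLDUniform` (stmt-AtomisticToContinuum-14662; lines `local-gibbs-entropy-ledger`,
`Sketch`, `sigma-uniform-equilibrium-transfer`). The stub asks, for continuous positive profiles
`(a, θ₀, u₀)` and `0 < σ ≤ 1/2`, for an order `p > 1` with
`∫ (ψ∘Φ_{-r})^p ψ^{1-p} dL ≤ e^{pδ(N+1)}` uniformly over the kinetic window `r ∈ [0, τ(N+1)^{-1/3}]`
for all large `N` (`ψ` the canonical local Gibbs density, `L` the Liouville measure).

`stub_windowRenyi_of_transport` REDUCES the stub, verbatim, to ONE dynamical statement with no activity,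
no partition function and no Rényi packaging: the KINETIC-WINDOW EXPONENTIAL TIGHTNESS OF THE TESTED
MOMENTUM AND KINETIC-ENERGY FIELDS under the local Gibbs law — for continuous test fields `ϑ, J` there is
`s > 0` with `∫ exp(s(|E_ϑ(Φ_r z) - E_ϑ(z)| + |M_J(Φ_r z) - M_J(z)|)) dλ^N ≤ e^{κ(N+1)}` for every `κ > 0`,
all large `N`, uniformly over the window (`E_ϑ = energyObservable ϑ = Σᵢ ϑ(xᵢ)‖vᵢ‖²/2`,
`M_J = momentumObservable J = Σᵢ ⟪J(xᵢ), vᵢ⟫` of `Literature.Analysis.FluidPDE.CollisionalTransfer`).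
This is the honest dynamical content of the stub (the probe `windowRenyi-analysis.md` on the item shows
that the stub conversely implies the signed `(ϑ, J) = (1/θ₀, u₀/θ₀)` instance, and that collision-count
formulations are false at large-deviation scale).

Proof. On the hard-sphere domain `log ψ = -log Z + Σᵢ g̃(xᵢ) + M_J - E_ϑ` with `ϑ = 1/θ₀`,
`J = u₀/θ₀`, `g̃ = log a - (3/2) log(2πθ₀) - ‖u₀‖²/(2θ₀)` (expand the Maxwellian exponent), so for good
`w` and `z = Φ_r w`: `ψ(w)^p ψ(z)^{1-p} = ψ(w) exp((p-1)(H(w) - H(z)))`, `H = log(Z ψ)`. After the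
Liouville change of variables `z = Φ_r w` the Rényi integral is `E_λ[exp((p-1)(G + X))]` with the
position part `G = Σᵢ (g̃(xᵢ(0)) - g̃(xᵢ(r))) ≤ (N+1)κ + 2C r² E` (uniform continuity of `g̃`,
displacement `≤ ∫‖vᵢ‖`, Cauchy–Schwarz, `Σᵢ∫₀ʳ‖vᵢ‖² = 2Er` — the landed isothermal argument) and the
transport part `X ≤ |ΔE_ϑ| + |ΔM_J|`. With `p = 1 + s/2` and `e^{(u+v)/2} ≤ (e^u + e^v)/2` the integral
is at most the mean of the Gaussian energy moment `e^{pδ(N+1)/2}·∫e^{γE}dλ ≤ e^{pδ(N+1)}` (window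
`→ 0`) and of the transport moment `≤ e^{pδ(N+1)}` (the hypothesis at `κ = pδ`). The statics (modular
Hamiltonian, cocycle `stub_windowRenyi_prelim`, quadratic modulus, displacement–energy bound, choice of
`γ`, vanishing window) are in `…WindowRenyiOfTransportPrelim.lean`.
-/

noncomputable section

open MeasureTheory Set Filter
open scoped ENNReal Topology InnerProductSpace

namespace Summit.AtomisticToContinuum.HydrodynamicLimit.Theorems.KineticCurrentsWindowLDUniformLocalGibbs

open Literature.Analysis.FluidPDE (HardSphereFlow Config localMaxwellian canonicalDensity liouville
  hardSphereDomain tensorPow energyObservable momentumObservable)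
open Literature.MathematicalPhysics.KineticTheory (T3 V3 hsDiameter localGibbsLaw localGibbsMeasure
  localGibbsProfile)
open Literature.Analysis.FluidPDE Literature.MathematicalPhysics.KineticTheory

/-! ### The reduction -/

/-- **Rényi quasi-invariance of local Gibbs laws over a kinetic window from kinetic-window transport
tightness (registered helper `stub_windowRenyi_of_transport` of the shared stub `stub_windowRenyi`).**
If, under every local Gibbs law of hard spheres at fixed reduced density `σ ≤ 1/2`, the kinetic-energy
field tested against any continuous `ϑ` and the momentum field tested against any continuous `J` are
exponentially tight over the kinetic window (`∃ s > 0 ∀ τ ∀ κ ∀ Φ ∃ N₀ ∀ N ≥ N₀ ∀ r ∈ [0, τ(N+1)^{-1/3}]: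
∫ exp(s(|ΔE_ϑ| + |ΔM_J|)) dλ^N ≤ e^{κ(N+1)}`), then the registered Rényi quasi-invariance holds with
`p = 1 + s/2`, `s` the rate for `(ϑ, J) = (1/θ₀, u₀/θ₀)`: the position part of `log ψ` is paid by the
displacement–energy bound of the landed isothermal case, the velocity part is exactly the window change
of `M_{u₀/θ₀} − E_{1/θ₀}`. [folklore] -/
theorem stub_windowRenyi_of_transport :
    (∀ (a θ₀ : T3 → ℝ) (u₀ : T3 → V3), Continuous a → Continuous θ₀ → Continuous u₀ →
      (∀ x, 0 < a x) → (∀ x, 0 < θ₀ x) → ∀ σ : ℝ, 0 < σ → σ ≤ 1 / 2 →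
      ∀ (ϑ : T3 → ℝ) (J : T3 → V3), Continuous ϑ → Continuous J →
      ∃ s : ℝ, 0 < s ∧ ∀ τ : ℝ, 0 < τ → ∀ κ : ℝ, 0 < κ →
      ∀ Φ : (N : ℕ) →
        HardSphereFlow (Literature.Analysis.FluidPDE.Torus.geometry (Fin 3)) (hsDiameter σ N) (N + 1),
      ∃ N₀ : ℕ, ∀ N : ℕ, N₀ ≤ N → ∀ r ∈ Set.Icc (0 : ℝ) (τ * ((N : ℝ) + 1) ^ (-(1 / 3 : ℝ))),
        ∫⁻ z, ENNReal.ofReal (Real.exp (s *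
            (|energyObservable ϑ ((Φ N).flow r z) - energyObservable ϑ z| +
              |momentumObservable J ((Φ N).flow r z) - momentumObservable J z|)))
          ∂(localGibbsLaw σ a u₀ θ₀ N (Φ N)) ≤
        ENNReal.ofReal (Real.exp (κ * ((N : ℝ) + 1)))) →
    ∀ (a θ₀ : T3 → ℝ) (u₀ : T3 → V3), Continuous a → Continuous θ₀ → Continuous u₀ →
    (∀ x, 0 < a x) → (∀ x, 0 < θ₀ x) → ∀ σ : ℝ, 0 < σ → σ ≤ 1 / 2 →
    ∃ p : ℝ, 1 < p ∧ ∀ τ : ℝ, 0 < τ → ∀ δ : ℝ, 0 < δ →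
    ∀ Φ : (N : ℕ) →
      HardSphereFlow (Literature.Analysis.FluidPDE.Torus.geometry (Fin 3)) (hsDiameter σ N) (N + 1),
    ∃ N₀ : ℕ, ∀ N : ℕ, N₀ ≤ N → ∀ r ∈ Set.Icc (0 : ℝ) (τ * ((N : ℝ) + 1) ^ (-(1 / 3 : ℝ))),
      ∫⁻ z, ENNReal.ofReal (canonicalDensity (Literature.Analysis.FluidPDE.Torus.geometry (Fin 3))
            (hsDiameter σ N) (N + 1) (localGibbsProfile a u₀ θ₀) ((Φ N).flow (-r) z)) ^ p *
          ENNReal.ofReal (canonicalDensity (Literature.Analysis.FluidPDE.Torus.geometry (Fin 3))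
            (hsDiameter σ N) (N + 1) (localGibbsProfile a u₀ θ₀) z) ^ (1 - p)
        ∂(liouville (Literature.Analysis.FluidPDE.Torus.geometry (Fin 3)) (N + 1) (hsDiameter σ N)) ≤
      ENNReal.ofReal (Real.exp (p * (δ * ((N : ℝ) + 1)))) := by
  intro hT a θ₀ u₀ ha hθ hu ha0 hθ0 σ hσ hσ2
  -- the test fields of the modular Hamiltonian and the transport rate `s`
  have hϑc : Continuous fun x => (θ₀ x)⁻¹ := hθ.inv₀ fun x => (hθ0 x).ne'
  have hJc : Continuous fun x => (θ₀ x)⁻¹ • u₀ x := hϑc.smul hu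
  obtain ⟨s, hs0, hs⟩ := hT a θ₀ u₀ ha hθ hu ha0 hθ0 σ hσ hσ2 (fun x => (θ₀ x)⁻¹)
    (fun x => (θ₀ x)⁻¹ • u₀ x) hϑc hJc
  refine ⟨1 + s / 2, by linarith, ?_⟩
  intro τ hτ δ hδ Φ
  set p : ℝ := 1 + s / 2 with hp
  have hp0 : 0 < p := by rw [hp]; positivity
  have hps : p - 1 = s / 2 := by rw [hp]; ring
  -- the position part `g̃` of `log ψ` and its quadratic modulus
  set gt : T3 → ℝ := fun x => Real.log (a x) +
      (-(Module.finrank ℝ V3 : ℝ) / 2) * Real.log (2 * Real.pi * θ₀ x) -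
      (θ₀ x)⁻¹ * ‖u₀ x‖ ^ 2 / 2 with hgt
  have hgtc : Continuous gt := by
    refine ((ha.log fun x => (ha0 x).ne').add (continuous_const.mul
      ((continuous_const.mul hθ).log fun x => ?_))).sub ((hϑc.mul (hu.norm.pow 2)).div_const 2)
    exact (mul_pos (mul_pos two_pos Real.pi_pos) (hθ0 x)).ne'
  set κ : ℝ := p * δ / (2 * s) with hκ
  have hκ0 : 0 < κ := by positivity
  obtain ⟨C, hC0, hC⟩ := wre_sub_le_quad hgtc hκ0
  -- bounds of the profiles, the energy exponent `γ`, and the thresholds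
  obtain ⟨Θ, _, hΘ⟩ := exists_forall_abs_le_of_continuous hθ
  obtain ⟨U, _, hU⟩ := exists_forall_abs_le_of_continuous hu.norm
  have hΘ' : ∀ x, θ₀ x ≤ Θ := fun x => (le_abs_self _).trans (hΘ x)
  have hU' : ∀ x, ‖u₀ x‖ ≤ U := fun x => (le_abs_self _).trans (hU x)
  have hΘ0 : 0 < Θ := (hθ0 0).trans_le (hΘ' 0)
  have hδ' : 0 < p * δ / 2 := by positivity
  obtain ⟨γ, hγ0, hγΘ, hK⟩ := wre_exists_gamma hΘ0 hδ' U
  obtain ⟨N₁, hN₁⟩ := wre_exists_N0 τ (s * C) hγ0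
  obtain ⟨N₂, hN₂⟩ := hs τ hτ (p * δ) (by positivity) Φ
  refine ⟨max N₁ N₂, fun N hN r hr => ?_⟩
  have hN1 : N₁ ≤ N := le_of_max_le_left hN
  have hN2 : N₂ ≤ N := le_of_max_le_right hN
  -- the Liouville measure, the density `ψ`, the law `λ`
  set L := liouville (Torus.geometry (Fin 3)) (N + 1) (hsDiameter σ N) with hL
  set ψr : Config (N + 1) (Fin 3) T3 → ℝ := fun z =>
    canonicalDensity (Torus.geometry (Fin 3)) (hsDiameter σ N) (N + 1) (localGibbsProfile a u₀ θ₀) z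
    with hψr
  set ψ : Config (N + 1) (Fin 3) T3 → ℝ≥0∞ := fun z => ENNReal.ofReal (ψr z) with hψ
  have hlaw : localGibbsLaw σ a u₀ θ₀ N (Φ N) = L.withDensity ψ := by
    simp only [localGibbsLaw, particleLaw_eq, hL, hψ, hψr]
  have hψm : Measurable ψ :=
    (measurable_canonicalDensity (hsDiameter σ N) (N + 1)
      (measurable_localGibbsProfile ha hθ hu)).ennreal_ofReal
  -- the two exponential weights
  set F₁ : Config (N + 1) (Fin 3) T3 → ℝ≥0∞ := fun w => ENNReal.ofReal
    (Real.exp (s * (((N + 1 : ℕ) : ℝ) * κ + C * (2 * r ^ 2 * configEnergy w)))) with hF₁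
  set F₂ : Config (N + 1) (Fin 3) T3 → ℝ≥0∞ := fun w => ENNReal.ofReal (Real.exp (s *
    (|energyObservable (fun x => (θ₀ x)⁻¹) ((Φ N).flow r w) -
        energyObservable (fun x => (θ₀ x)⁻¹) w| +
      |momentumObservable (fun x => (θ₀ x)⁻¹ • u₀ x) ((Φ N).flow r w) -
        momentumObservable (fun x => (θ₀ x)⁻¹ • u₀ x) w|))) with hF₂
  have hEm : Measurable fun z : Config (N + 1) (Fin 3) T3 => configEnergy z := by
    unfold configEnergy
    exact measurable_const.mul (Finset.measurable_sum _ fun i _ =>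
      ((measurable_pi_apply i).snd.norm.pow_const 2))
  have hF₁m : Measurable F₁ :=
    (Real.measurable_exp.comp (measurable_const.mul (measurable_const.add
      (measurable_const.mul (measurable_const.mul hEm))))).ennreal_ofReal
  have hEobs : Measurable fun z : Config (N + 1) (Fin 3) T3 =>
      energyObservable (fun x => (θ₀ x)⁻¹) z := by
    unfold energyObservable
    exact Finset.measurable_sum _ fun i _ =>
      (hϑc.measurable.comp (measurable_pi_apply i).fst).mul
        (((measurable_pi_apply i).snd.norm.pow_const 2).div_const 2)
  have hMobs : Measurable fun z : Config (N + 1) (Fin 3) T3 =>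
      momentumObservable (fun x => (θ₀ x)⁻¹ • u₀ x) z := by
    unfold momentumObservable
    exact Finset.measurable_sum _ fun i _ =>
      (hJc.measurable.comp (measurable_pi_apply i).fst).inner (measurable_pi_apply i).snd
  have hF₂m : Measurable F₂ :=
    (Real.measurable_exp.comp (measurable_const.mul
      (((hEobs.comp ((Φ N).measurable_flow r)).sub hEobs).abs.add
        ((hMobs.comp ((Φ N).measurable_flow r)).sub hMobs).abs))).ennreal_ofReal
  -- Step 1: Liouville change of variables `z = Φ_r w`
  have h1 : ∫⁻ z, ψ ((Φ N).flow (-r) z) ^ p * ψ z ^ (1 - p) ∂L =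
      ∫⁻ w, ψ w ^ p * ψ ((Φ N).flow r w) ^ (1 - p) ∂L := by
    have hmeas : Measurable fun z => ψ ((Φ N).flow (-r) z) ^ p * ψ z ^ (1 - p) :=
      ((hψm.comp ((Φ N).measurable_flow (-r))).pow_const p).mul (hψm.pow_const (1 - p))
    rw [← ((Φ N).measurePreserving r).lintegral_comp hmeas]
    refine lintegral_congr_ae ?_
    filter_upwards [(Φ N).ae_mem_good] with w hw
    simp only [(Φ N).flow_neg_flow r hw]
  -- Step 2: pointwise bound on the good set
  have hpt : ∀ᵐ w ∂L, ψ w ^ p * ψ ((Φ N).flow r w) ^ (1 - p) ≤ ψ w * ((F₁ w + F₂ w) / 2) := by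
    filter_upwards [(Φ N).ae_mem_good] with w hw
    have hz : (Φ N).flow r w ∈ (Φ N).good := (Φ N).mapsTo_good r hw
    have hDw := (Φ N).good_subset hw
    have hDz := (Φ N).good_subset hz
    have hwpos : 0 < ψr w := wre_canonicalDensity_pos_of_mem ha hθ hu ha0 hθ0 hσ2 hDw
    have hw0 : ψ w ≠ 0 := (ENNReal.ofReal_pos.2 hwpos).ne'
    -- the exponent: position part + transport part (the cocycle of the Prelim)
    set B₁ : ℝ := ((N + 1 : ℕ) : ℝ) * κ + C * (2 * r ^ 2 * configEnergy w) with hB₁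
    set B₂ : ℝ := |energyObservable (fun x => (θ₀ x)⁻¹) ((Φ N).flow r w) -
          energyObservable (fun x => (θ₀ x)⁻¹) w| +
        |momentumObservable (fun x => (θ₀ x)⁻¹ • u₀ x) ((Φ N).flow r w) -
          momentumObservable (fun x => (θ₀ x)⁻¹ • u₀ x) w| with hB₂
    set D : ℝ := ((∑ i, gt ((Φ N).flow r w i).1) - ∑ i, gt (w i).1) +
        (momentumObservable (fun x => (θ₀ x)⁻¹ • u₀ x) ((Φ N).flow r w) -
          momentumObservable (fun x => (θ₀ x)⁻¹ • u₀ x) w) -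
        (energyObservable (fun x => (θ₀ x)⁻¹) ((Φ N).flow r w) -
          energyObservable (fun x => (θ₀ x)⁻¹) w) with hD
    have hcoc : ψr ((Φ N).flow r w) = ψr w * Real.exp D := by
      simp only [hψr, hD, hgt]
      exact stub_windowRenyi_prelim a θ₀ u₀ ha0 hθ0 σ N w ((Φ N).flow r w) hDw hDz
    have hG : ∑ i, (gt (w i).1 - gt ((Φ N).flow r w i).1) ≤ B₁ :=
      wre_sum_ratio_le (Φ N) hw hC0 hC hr.1
    have hexp : (1 - p) * D ≤ (s * B₁ + s * B₂) / 2 := by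
      have hX : (momentumObservable (fun x => (θ₀ x)⁻¹ • u₀ x) w -
            momentumObservable (fun x => (θ₀ x)⁻¹ • u₀ x) ((Φ N).flow r w)) -
          (energyObservable (fun x => (θ₀ x)⁻¹) w -
            energyObservable (fun x => (θ₀ x)⁻¹) ((Φ N).flow r w)) ≤ B₂ := by
        rw [hB₂]
        have h1 := le_abs_self (energyObservable (fun x => (θ₀ x)⁻¹) ((Φ N).flow r w) -
          energyObservable (fun x => (θ₀ x)⁻¹) w)
        have h2 := neg_abs_le (momentumObservable (fun x => (θ₀ x)⁻¹ • u₀ x) ((Φ N).flow r w) -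
          momentumObservable (fun x => (θ₀ x)⁻¹ • u₀ x) w)
        linarith
      have hG' : (∑ i, gt (w i).1) - ∑ i, gt ((Φ N).flow r w i).1 ≤ B₁ := by
        rw [← Finset.sum_sub_distrib]; exact hG
      have hsum := mul_le_mul_of_nonneg_left (add_le_add hG' hX) (by positivity : 0 ≤ s / 2)
      have h1p : 1 - p = -(s / 2) := by rw [hp]; ring
      rw [h1p, hD]
      linarith
    have hle : Real.exp ((1 - p) * D) ≤ (Real.exp (s * B₁) + Real.exp (s * B₂)) / 2 :=
      (Real.exp_le_exp.2 hexp).trans (ClampedTransferCoin.RadialVirial.radialVirialTemplate_exp_half_add_le _ _)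
    -- the `ℝ≥0∞` algebra `ψ(w)^p ψ(z)^{1-p} = ψ(w) e^{(1-p) D}`
    calc ψ w ^ p * ψ ((Φ N).flow r w) ^ (1 - p)
        = ENNReal.ofReal (ψr w) ^ p *
            (ENNReal.ofReal (ψr w) * ENNReal.ofReal (Real.exp D)) ^ (1 - p) := by
          simp only [hψ]
          rw [hcoc, ENNReal.ofReal_mul hwpos.le]
      _ = ENNReal.ofReal (ψr w) * ENNReal.ofReal (Real.exp D) ^ (1 - p) := by
          rw [ENNReal.mul_rpow_of_ne_top ENNReal.ofReal_ne_top ENNReal.ofReal_ne_top, ← mul_assoc,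
            ← ENNReal.rpow_add p (1 - p) hw0 ENNReal.ofReal_ne_top,
            show p + (1 - p) = 1 by ring, ENNReal.rpow_one]
      _ = ENNReal.ofReal (ψr w) * ENNReal.ofReal (Real.exp ((1 - p) * D)) := by
          rw [ENNReal.ofReal_rpow_of_pos (Real.exp_pos _), ← Real.exp_mul, mul_comm D (1 - p)]
      _ ≤ ENNReal.ofReal (ψr w) *
            ENNReal.ofReal ((Real.exp (s * B₁) + Real.exp (s * B₂)) / 2) :=
          mul_le_mul_right (ENNReal.ofReal_le_ofReal hle) _
      _ = ψ w * ((F₁ w + F₂ w) / 2) := by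
          simp only [hψ, hF₁, hF₂, hB₁, hB₂]
          rw [ENNReal.ofReal_div_of_pos two_pos,
            ENNReal.ofReal_add (Real.exp_nonneg _) (Real.exp_nonneg _), ENNReal.ofReal_ofNat]
  -- Step 3: the two moments under the local Gibbs law
  have hcN : Real.exp (s * (((N + 1 : ℕ) : ℝ) * κ)) = Real.exp (p * δ / 2 * ((N : ℝ) + 1)) := by
    congr 1
    rw [hκ]
    field_simp
    push_cast
    ring
  have hKN : (Real.exp (γ * U ^ 2) * (1 - 2 * γ * Θ) ^ (-(3 : ℝ) / 2)) ^ (N + 1) ≤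
      Real.exp (p * δ / 2 * ((N : ℝ) + 1)) := by
    have hK0 : 0 ≤ Real.exp (γ * U ^ 2) * (1 - 2 * γ * Θ) ^ (-(3 : ℝ) / 2) :=
      mul_nonneg (Real.exp_nonneg _) (Real.rpow_nonneg (by linarith) _)
    refine (pow_le_pow_left₀ hK0 hK (N + 1)).trans_eq ?_
    rw [← Real.exp_nat_mul]
    congr 1
    push_cast
    ring
  have hγr : s * (C * (2 * r ^ 2)) ≤ γ := by
    have h4 : 2 * r ^ 2 ≤ 4 * (τ * ((N : ℝ) + 1) ^ (-(1 / 3 : ℝ))) ^ 2 := by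
      nlinarith [pow_le_pow_left₀ hr.1 hr.2 2, sq_nonneg r]
    have := mul_le_mul_of_nonneg_left h4 (by positivity : 0 ≤ s * C)
    nlinarith [hN₁ N hN1]
  have hI₁ : ∫⁻ w, F₁ w ∂(localGibbsLaw σ a u₀ θ₀ N (Φ N)) ≤
      ENNReal.ofReal (Real.exp (p * (δ * ((N : ℝ) + 1)))) := by
    have hsplit : ∀ w, F₁ w = ENNReal.ofReal (Real.exp (s * (((N + 1 : ℕ) : ℝ) * κ))) *
        ENNReal.ofReal (Real.exp (s * (C * (2 * r ^ 2)) * configEnergy w)) := by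
      intro w
      simp only [hF₁]
      rw [← ENNReal.ofReal_mul (Real.exp_nonneg _), ← Real.exp_add]
      congr 2
      ring
    have hmono : ∀ w : Config (N + 1) (Fin 3) T3,
        ENNReal.ofReal (Real.exp (s * (C * (2 * r ^ 2)) * configEnergy w)) ≤
        ENNReal.ofReal (Real.exp (γ * configEnergy w)) := fun w => by
      have hE0 : 0 ≤ configEnergy w := by
        show (0 : ℝ) ≤ 2⁻¹ * ∑ i, ‖(w i).2‖ ^ 2
        exact mul_nonneg (by norm_num) (Finset.sum_nonneg fun i _ => sq_nonneg _)
      exact ENNReal.ofReal_le_ofReal (Real.exp_le_exp.2 (mul_le_mul_of_nonneg_right hγr hE0))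
    have hγm : Measurable fun w : Config (N + 1) (Fin 3) T3 =>
        ENNReal.ofReal (Real.exp (s * (C * (2 * r ^ 2)) * configEnergy w)) :=
      (Real.measurable_exp.comp (measurable_const.mul hEm)).ennreal_ofReal
    calc ∫⁻ w, F₁ w ∂(localGibbsLaw σ a u₀ θ₀ N (Φ N))
        = ENNReal.ofReal (Real.exp (s * (((N + 1 : ℕ) : ℝ) * κ))) *
            ∫⁻ w, ENNReal.ofReal (Real.exp (s * (C * (2 * r ^ 2)) * configEnergy w))
              ∂(localGibbsLaw σ a u₀ θ₀ N (Φ N)) := by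
          simp_rw [hsplit]
          rw [lintegral_const_mul _ hγm]
      _ ≤ ENNReal.ofReal (Real.exp (p * δ / 2 * ((N : ℝ) + 1))) *
            ENNReal.ofReal ((Real.exp (γ * U ^ 2) * (1 - 2 * γ * Θ) ^ (-(3 : ℝ) / 2)) ^ (N + 1)) := by
          rw [hcN]
          exact mul_le_mul_right ((lintegral_mono hmono).trans
            (lintegral_exp_mul_configEnergy_localGibbsLaw_le ha hθ hu ha0 hθ0 hσ2 N (Φ N)
              hγ0.le hΘ' hU' hγΘ)) _
      _ ≤ ENNReal.ofReal (Real.exp (p * δ / 2 * ((N : ℝ) + 1))) *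
            ENNReal.ofReal (Real.exp (p * δ / 2 * ((N : ℝ) + 1))) :=
          mul_le_mul_right (ENNReal.ofReal_le_ofReal hKN) _
      _ = ENNReal.ofReal (Real.exp (p * (δ * ((N : ℝ) + 1)))) := by
          rw [← ENNReal.ofReal_mul (Real.exp_nonneg _), ← Real.exp_add]
          congr 2
          ring
  have hI₂ : ∫⁻ w, F₂ w ∂(localGibbsLaw σ a u₀ θ₀ N (Φ N)) ≤
      ENNReal.ofReal (Real.exp (p * (δ * ((N : ℝ) + 1)))) := by
    have h := hN₂ N hN2 r hr
    rwa [mul_assoc] at h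
  -- Step 4: assemble
  have hF12 : Measurable fun w => F₁ w + F₂ w := hF₁m.add hF₂m
  have hF12d : Measurable fun w => (F₁ w + F₂ w) / 2 := hF12.div_const 2
  calc ∫⁻ z, ψ ((Φ N).flow (-r) z) ^ p * ψ z ^ (1 - p) ∂L
      = ∫⁻ w, ψ w ^ p * ψ ((Φ N).flow r w) ^ (1 - p) ∂L := h1
    _ ≤ ∫⁻ w, ψ w * ((F₁ w + F₂ w) / 2) ∂L := lintegral_mono_ae hpt
    _ = ∫⁻ w, (F₁ w + F₂ w) / 2 ∂(localGibbsLaw σ a u₀ θ₀ N (Φ N)) := by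
        rw [hlaw, lintegral_withDensity_eq_lintegral_mul L hψm hF12d]
        simp only [Pi.mul_apply]
    _ = (∫⁻ w, F₁ w ∂(localGibbsLaw σ a u₀ θ₀ N (Φ N)) +
          ∫⁻ w, F₂ w ∂(localGibbsLaw σ a u₀ θ₀ N (Φ N))) / 2 := by
        simp only [div_eq_mul_inv]
        rw [lintegral_mul_const _ hF12, lintegral_add_left hF₁m]
    _ ≤ (ENNReal.ofReal (Real.exp (p * (δ * ((N : ℝ) + 1)))) +
          ENNReal.ofReal (Real.exp (p * (δ * ((N : ℝ) + 1))))) / 2 :=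
        ENNReal.div_le_div_right (add_le_add hI₁ hI₂) 2
    _ = ENNReal.ofReal (Real.exp (p * (δ * ((N : ℝ) + 1)))) := by
        rw [ENNReal.add_div, ENNReal.add_halves]

end Summit.AtomisticToContinuum.HydrodynamicLimit.Theorems.KineticCurrentsWindowLDUniformLocalGibbs

end
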